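import Summits.BirchSwinnertonDyer.Rank1Residual.SmallImageMu.ConjARoad
import Summits.BirchSwinnertonDyer.Rank1Residual.SmallImageMu.KatoDivisibility
import Literature.NumberTheory.EllipticCurves.Rank1Residual.MuLambdaCarriers
import Summits.BirchSwinnertonDyer.Rank1Residual.CoatesSujathaConjectureA
import Literature.NumberTheory.EllipticCurves.FineSelmerClassGroupCriterion
import Literature.NumberTheory.EllipticCurves.Kato2004.DivisibilityInputsFine
import Summits.BirchSwinnertonDyer.Rank1Residual.X10.CoreTheoremAOddPrimeHolds
import Summits.BirchSwinnertonDyer.Rank1Residual.SmallImageMu.EulerPrimitive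
import Summits.BirchSwinnertonDyer.BirchSwinnertonDyer.Theorems.KatoDescentPotSupersingularFineSelmerLeSignedSelmer
import Literature.NumberTheory.EllipticCurves.IwasawaOrderOfVanishingProofs
import Literature.NumberTheory.EllipticCurves.KatoRankBoundProofs
import Literature.NumberTheory.EllipticCurves.IwasawaSelmerDualProofs
import HarnessLib
import HarnessLib.Audit

/-!
# Kernel glue of the CONJ-A ROAD: `CoatesSujathaConjectureA` ⟹ DESC-A; K1 ⟹ DESC-A (CS05 Thm 3.4);
# K1′ ⟹ DESC-A (given the paper lemma T2); ES-C2 ⟹ DESC-A (kernel, unconditional);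
# DESC-A + T0 + S-W⁺ + F1 + BCS (a) ⟹ `KatoDivisibilityOnClassX9` (the road to the class leaf
# `BSDpOnClassX9` through the landed four-twist squeeze is the sibling `ConjARoadBSDp.lean`)

HONEST FRAMING (cell `bsd-f3-mu`).  THEOREMS ONLY, sorry-free; nothing booked; every statement is
conditional on the open nodes in its hypotheses and/or on PUBLISHED named facts taken as binders
(`h34` = Coates–Sujatha 2005 Thm 3.4, `hfine` = Kato's divisibility inputs with the fine quotient
(F1 family), `hBCS` = BCS 2025 Thm 1.1.2 (a), `hmodP` = modularity) and on the desc
lens's PROVABLE support items taken as explicit HYPOTHESES, never asserted: T0 `hT0` («(A) at the pair ⟹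
pointwise `μ(X₀) = 0`», size S), T2 `hT2` (tame isotypic restriction `μ_p(ℚ(P)) = 0 ⟹ (A)`, size M /
definition D4), S-W⁺ `hSW` (`Rank1Residual.MuDefectLeFineMuAt` on X9, Kato §17.13, size M).  Ported from
the planner's checked `HOME/desc/Sketch2.lean` §1–§4 (sha16 b490b220666e0690, rc 0) onto the filed names;
the existence of a finitely generated torsion fine datum over every cyclotomic datum (the planner's
binder `hY`) is DISCHARGED here from F1 + BCS (a) (`exists_fineSelmerDualData_finite_isTorsion`).

References: [CoatesSujatha2005] Conj. A, Thm. 3.4; [Kato2004Asterisque] Thm. 12.4, §17.13;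
[BurungaleCastellaSkinner2025] Thm. 1.1.2 (a), (5.3); [Wuthrich2006] Thm. 2; HOME MEMO-desc.md §9.
-/

-- the summit and its single problem are both named `BirchSwinnertonDyer` (registry layout D-0017)
set_option linter.dupNamespace false

noncomputable section

open scoped Classical MatrixGroups ModularForm
open CongruenceSubgroup WeierstrassCurve Field Literature.NumberTheory.EllipticCurves
  Literature.NumberTheory.EllipticCurves.ModularForms Literature.NumberTheory.IwasawaTheory
  Literature.NumberTheory.EllipticCurves.BurungaleCastellaSkinner2025
  Literature.NumberTheory.EllipticCurves.Kato2004
  Literature.NumberTheory.EllipticCurves.Kato2004.EulerSystemValues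
  Summit.BirchSwinnertonDyer.BirchSwinnertonDyer.Rank1Residual
open Literature.NumberTheory.EllipticCurves.Rank1Residual (ConjAAt FineMuZeroAt MuDefectLeFineMuAt
  MuDefectNonposAt isTorsion_of_bcs)

namespace Summit.BirchSwinnertonDyer.Rank1Residual.SmallImageMu

/-! ## §1 Sources of DESC-A -/

/-- **The general node `CoatesSujathaConjectureA` ⟹ DESC-A** (instantiation at `K = ℚ`; X9 pairs have
`p ≥ 5`, so `p ≠ 2`). [cite: CoatesSujatha2005, Conjecture A (§3)] -/
theorem conjAOnClassX9_of_coatesSujathaConjectureA (h : FineSelmer.CoatesSujathaConjectureA) :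
    ConjAOnClassX9 := by
  intro W _ _ p _ hX9 κ hκ
  obtain ⟨-, hp, -⟩ := id hX9
  exact h ℚ W p (by omega) κ hκ

/-- **K1 ⟹ DESC-A** (kernel, by the typed Coates–Sujatha Thm 3.4). [cite: CoatesSujatha2005, Thm. 3.4 (§3)] -/
theorem conjAOnClassX9_of_divisionFieldClassicalMuZero
    (h34 : CoatesSujatha2005.thm34_fineSelmerDual_moduleFinite_of_classicalMuVanishes_divisionField)
    (hK1 : DivisionFieldClassicalMuZeroOnClassX9) : ConjAOnClassX9 := by
  intro W _ _ p _ hX9 κ hκ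
  obtain ⟨-, hp, -⟩ := id hX9
  exact h34 W p (by omega) (hK1 W p hX9) κ hκ

/-- **K1′ ⟹ DESC-A, given the desc lens's paper lemma T2** (tame ISOTYPIC restriction: on X9,
`μ_p(ℚ(P)^{cyc}) = 0` for one nonzero `P ∈ E[p]` ⟹ (A) at `(E, p)`; `p ∤ #Gal(ℚ(E[p])/ℚ)`, Maschke +
Schur + `E[p]^{Stab P} ∋ P ≠ 0`; sharper than CS05 Thm 3.4 — taken as the HYPOTHESIS `hT2`, a prover's
item needing the dictionary D4, NOT asserted). [cite: CoatesSujatha2005, Thm. 3.4 (§3) — the form T2 sharpens] -/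
theorem conjAOnClassX9_of_torsionPointFieldClassicalMuZero
    (hT2 : ∀ (W : WeierstrassCurve ℚ) [W.IsElliptic] [W.IsGloballyMinimal] (p : ℕ) [Fact p.Prime],
      ClassX9 W p →
      (∃ P : geomTorsion W (p : ℤ), P ≠ 0 ∧
        ∀ κ : ZpExtension
            (IntermediateField.fixedField (MulAction.stabilizer (Field.absoluteGaloisGroup ℚ) P)) p,
          κ.IsCyclotomic → ClassicalMuVanishes κ) →
      ConjAAt W p)
    (hK1' : TorsionPointFieldClassicalMuZeroOnClassX9) : ConjAOnClassX9 :=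
  fun W _ _ p _ hX9 => hT2 W p hX9 (hK1' W p hX9)

/-- **ES-C2 ⟹ DESC-A, UNCONDITIONALLY (kernel)**: Euler-primitivity on X9 (the `-es` node
`EulerPrimitiveOnClassX9`) gives, at the normalised cyclotomic datum `(κ₀, γ₀)`
(`exists_isCyclotomic_isTopGenerator_isCyclotomicVariable_holds`), the core conclusion on X9 by the KERNEL
theorem `X10.coreTheoremAOddPrime_holds` — `Sel₀(ℚ_∞, E[p^∞])[p]` is killed by a power of `γ₀ − 1`,
hence finite (`finite_fineSelmerInfty_pTorsion_of_forall_iterate_eq_zero`); finiteness of `Sel₀[p]`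
only sees `ker κ` (all cyclotomic `κ` share it, `ZpExtension.IsCyclotomic.kerSubgroup_eq`), and gives
(A) in the tree's `∃`-form (`FineSelmerLeSignedSelmer.conjA_of_finite_fineSelmerInfty_pTorsion`:
`X₀/p` finite ⟹ torsion, `μ = 0` ⟹ f.g. over `ℤ_p`).  No F1, no BCS, no modularity: the two gen-1
roads (Euler-primitivity, Conj A) MEET at DESC-A in the kernel.
[cite: Kato2004Asterisque, Thm. 12.6 (p. 222) and §13.8 (shape of the core)] [cite: CoatesSujatha2005, §3 (Conjecture A and Lemma 3.1)] -/
theorem conjAOnClassX9_of_eulerPrimitiveOnClassX9 (h : EulerPrimitiveOnClassX9) : ConjAOnClassX9 := by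
  intro W _ _ p _ hX9 κ hκ
  haveI : ContinuousSMul ℤ_[p] (W.tateModule p) := TateModule.continuousSMul_padicInt
  haveI : Module.Free ℤ_[p] (W.tateModule p) := W.module_free_tateModule_holds p
  haveI : Module.Finite ℤ_[p] (W.tateModule p) := W.module_finite_tateModule_holds p
  obtain ⟨κ₀, hκ₀, γ₀, hγ₀, hγ₀c⟩ := exists_isCyclotomic_isTopGenerator_isCyclotomicVariable_holds p
  obtain ⟨I⟩ := nonempty_iwasawaH1Data_holds W p κ₀ γ₀ hκ₀ hγ₀
  obtain ⟨J, hJ⟩ :=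
    Summit.BirchSwinnertonDyer.Rank1Residual.X10.coreTheoremA_classX9_of_oddPrime
      Summit.BirchSwinnertonDyer.Rank1Residual.X10.coreTheoremAOddPrime_holds W p κ₀ γ₀ I hX9 hκ₀ hγ₀
      (h W p κ₀ γ₀ I hX9 hκ₀ hγ₀ hγ₀c)
  have h0₀ : Set.Finite {s : W.fineSelmerInfty κ₀ | p • s = 0} :=
    W.finite_fineSelmerInfty_pTorsion_of_forall_iterate_eq_zero κ₀ hγ₀ hJ
  have hker : κ₀.kerSubgroup = κ.kerSubgroup := ZpExtension.IsCyclotomic.kerSubgroup_eq hκ₀ hκ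
  have h0 : Set.Finite {s : W.fineSelmerInfty κ | p • s = 0} := by
    -- `Sel₀(K_∞, E[p^∞])` only sees `K̄^{ker κ}`: transport along the equality of kernels (`subst`)
    have aux : ∀ {H₀ H : Subgroup (absoluteGaloisGroup ℚ)} [H₀.Normal] [H.Normal], H₀ = H →
        Set.Finite {s : GreenbergSelmer.strictSelmerGroupOver H₀ (W.geomPrimaryTorsion p) p
          (GreenbergSelmer.fineData (W.geomPrimaryTorsion p) p) | p • s = 0} →
        Set.Finite {s : GreenbergSelmer.strictSelmerGroupOver H (W.geomPrimaryTorsion p) p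
          (GreenbergSelmer.fineData (W.geomPrimaryTorsion p) p) | p • s = 0} := by
      intro H₀ H _ _ hH hf
      subst hH
      exact hf
    exact aux hker h0₀
  obtain ⟨γ, hγ⟩ : ∃ γ : absoluteGaloisGroup ℚ, κ.IsTopGenerator γ :=
    κ.surjective (Multiplicative.ofAdd 1)
  exact Summit.BirchSwinnertonDyer.BirchSwinnertonDyer.Theorems.FineSelmerLeSignedSelmer.conjA_of_finite_fineSelmerInfty_pTorsion
    W κ hγ h0

/-! ## §2 DESC-A ⟹ the node -/

/-- **Over every cyclotomic datum of a pair `p ≥ 5`, good ordinary, `E[p]` irreducible, SOME dual fine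
Selmer datum is finitely generated and torsion over `Λ`** (the planner's binder `hY`, discharged): the
pinned datum is a quotient of `X(E/ℚ_∞)` (F1: Kato's divisibility inputs with the fine quotient,
`Kato2004.exists_divisibilityInputs_fineQuotient`), which is finitely generated (cyclotomic) and torsion
(BCS (a) clause 1, `Rank1Residual.isTorsion_of_bcs`).
[cite: Kato2004Asterisque, Thm. 12.4 and §17.13 (pp. 279–280)] [cite: BurungaleCastellaSkinner2025, Thm. 1.1.2 (a)] -/
theorem exists_fineSelmerDualData_finite_isTorsion (hmodP : nonempty_modularParametrizationData)
    (hfine : exists_divisibilityInputs_fineQuotient)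
    (hBCS : burungale_castella_skinner_charIdeal_eq_padicLFunction)
    {W : WeierstrassCurve ℚ} [W.IsElliptic] [W.IsGloballyMinimal] {p : ℕ} [Fact p.Prime]
    (hp : 5 ≤ p) (hgood : W.HasGoodReductionAtPrime p) (hord : ¬ (p : ℤ) ∣ W.frobeniusTrace p)
    (hirr : W.HasIrreducibleModPGaloisRep p) :
    ∀ (κ : ZpExtension ℚ p) (γ : Field.absoluteGaloisGroup ℚ),
      κ.IsCyclotomic → κ.IsTopGenerator γ → IsCyclotomicVariable p γ →
      ∃ Y : W.FineSelmerDualData κ γ,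
        Module.Finite (IwasawaAlgebra p) Y.X ∧ Module.IsTorsion (IwasawaAlgebra p) Y.X := by
  intro κ γ hκ hγ hγ'
  have hp2 : p ≠ 2 := by omega
  haveI : ContinuousSMul ℤ_[p] (W.tateModule p) := TateModule.continuousSMul_padicInt
  haveI : NeZero (W.conductorNorm ℤ) := ⟨(W.conductorNorm_pos_holds).ne'⟩
  obtain ⟨Dm⟩ := hmodP W
  obtain ⟨I⟩ := nonempty_iwasawaH1Data_holds W p κ γ hκ hγ
  let D : W.SelmerDualData κ γ := W.selmerDualData κ hγ
  haveI : Module.Finite (IwasawaAlgebra p) D.X :=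
    WeierstrassCurve.SelmerDualData.module_finite_of_isCyclotomic W κ hκ D hγ
  obtain ⟨Y⟩ := W.nonempty_fineSelmerDualData κ hγ
  obtain ⟨K, π, hπs, -⟩ := hfine W p Dm.f κ γ hp2 ⟨hgood, hord⟩ hκ hγ hγ' Dm.isNewformOf I D Y
  have hDt : D.IsTorsion := isTorsion_of_bcs hBCS hmodP hp hgood hord hirr κ γ hκ hγ hγ' D
  exact ⟨Y, Module.Finite.of_surjective π hπs, Kato2004.isTorsion_of_surjective π hπs hDt⟩

/-- **DESC-A ⟹ the node** (kernel): Conjecture A on X9 + T0 («(A) at the pair ⟹ pointwise `μ(X₀) = 0`»,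
HYPOTHESIS `hT0`) + S-W⁺ on X9 (`k ≤ μ(X₀)`, HYPOTHESIS `hSW`) + F1 + BCS (a) + modularity ⟹
`KatoDivisibilityOnClassX9`, via the carrier bridge `MuDefectLeFineMuAt.muDefectNonposAt` and, per pair,
`MuDefectNonposAt.katoDivisibilityAt` (BCS (a)) — the reading `katoDivisibilityOnClassX9_iff_muDefectNonpos`
of `KatoDivisibilityEdges.lean`, inlined to keep this file outside the SmallImageMuTransfer route's cone.  NO `μ(X) = 0`, NO `μ(L_p) = 0`, NO unit/Coleman
condition among the hypotheses.
[cite: Kato2004Asterisque, §17.13 (pp. 279–280)] [cite: BurungaleCastellaSkinner2025, Thm. 1.1.2 (a)] -/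
theorem katoDivisibilityOnClassX9_of_conjAOnClassX9
    (hBCS : burungale_castella_skinner_charIdeal_eq_padicLFunction)
    (hmodP : nonempty_modularParametrizationData) (hfine : exists_divisibilityInputs_fineQuotient)
    (hT0 : ∀ (W : WeierstrassCurve ℚ) [W.IsElliptic] (p : ℕ) [Fact p.Prime], p ≠ 2 →
      ConjAAt W p → FineMuZeroAt W p)
    (hSW : ∀ (W : WeierstrassCurve ℚ) [W.IsElliptic] [W.IsGloballyMinimal] (p : ℕ) [Fact p.Prime],
      ClassX9 W p → MuDefectLeFineMuAt W p)
    (hA : ConjAOnClassX9) : KatoDivisibilityOnClassX9 := by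
  intro W _ _ p _ κ γ N _ f hX9 hκ hγ hγ' hf D
  obtain ⟨-, hp, hgood, hord, hirr, -⟩ := id hX9
  have hk : MuDefectNonposAt W p :=
    (hSW W p hX9).muDefectNonposAt (hT0 W p (by omega) (hA W p hX9))
      (exists_fineSelmerDualData_finite_isTorsion hmodP hfine hBCS hp hgood hord hirr)
  exact (hk.katoDivisibilityAt hBCS hp hgood hord hirr) κ γ f hκ hγ hγ' hf D

/-! ## §3 With T0 proved (carrier theorem `ConjAAt.fineMuZeroAt`): the node from DESC-A / ES-C2
without the T0 hypothesis -/

/-- **DESC-A ⟹ the node, T0 DISCHARGED** (kernel): Conjecture A on X9 + S-W⁺ on X9 (`k ≤ μ(X₀)`,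
HYPOTHESIS `hSW` — the line's one remaining M-sized stub besides the open node) + F1 + BCS (a) +
modularity ⟹ `KatoDivisibilityOnClassX9`; T0 is now the carrier theorem `Rank1Residual.ConjAAt.fineMuZeroAt`
(stub `stub_fineMuZero_of_conjA` of line `conj-a-road-fine`, proof by `-ref1` g2, landed in
`MuLambdaCarriers.lean` §5). [cite: Kato2004Asterisque, §17.13 (pp. 279–280)] [cite: Washington1997, §13.2] -/
theorem katoDivisibilityOnClassX9_of_conjAOnClassX9'
    (hBCS : burungale_castella_skinner_charIdeal_eq_padicLFunction)
    (hmodP : nonempty_modularParametrizationData) (hfine : exists_divisibilityInputs_fineQuotient)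
    (hSW : ∀ (W : WeierstrassCurve ℚ) [W.IsElliptic] [W.IsGloballyMinimal] (p : ℕ) [Fact p.Prime],
      ClassX9 W p → MuDefectLeFineMuAt W p)
    (hA : ConjAOnClassX9) : KatoDivisibilityOnClassX9 :=
  katoDivisibilityOnClassX9_of_conjAOnClassX9 hBCS hmodP hfine (fun _ _ _ _ _ hA => hA.fineMuZeroAt)
    hSW hA

/-- **ES-C2 ⟹ the node through DESC-A** (kernel; T0 discharged): Euler-primitivity on X9 + S-W⁺ + F1 +
BCS (a) + modularity ⟹ `KatoDivisibilityOnClassX9`, composing `conjAOnClassX9_of_eulerPrimitiveOnClassX9`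
(unconditional) with `katoDivisibilityOnClassX9_of_conjAOnClassX9'` — the same inputs as the direct
Euler road `katoDivisibilityOnClassX9_of_eulerPrimitiveOnClassX9` (`EulerPrimitiveEdges.lean`, via
`μ(X₀) = 0` datum by datum), here via statement (A). [cite: Kato2004Asterisque, §17.13 (pp. 279–280)] -/
theorem katoDivisibilityOnClassX9_of_eulerPrimitiveOnClassX9_via_conjA
    (hBCS : burungale_castella_skinner_charIdeal_eq_padicLFunction)
    (hmodP : nonempty_modularParametrizationData) (hfine : exists_divisibilityInputs_fineQuotient)
    (hSW : ∀ (W : WeierstrassCurve ℚ) [W.IsElliptic] [W.IsGloballyMinimal] (p : ℕ) [Fact p.Prime],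
      ClassX9 W p → MuDefectLeFineMuAt W p)
    (h : EulerPrimitiveOnClassX9) : KatoDivisibilityOnClassX9 :=
  katoDivisibilityOnClassX9_of_conjAOnClassX9' hBCS hmodP hfine hSW
    (conjAOnClassX9_of_eulerPrimitiveOnClassX9 h)

end Summit.BirchSwinnertonDyer.Rank1Residual.SmallImageMu

end
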